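import Summits.QuantumFields.YangMills.Theorems.AlphaInputsT3ACv3AdaptedClass
import HarnessLib

/-!
# `AlphaInputsT3ACv3DataSchema` — STRATEGY B for 2′ (owner AMENDMENT (4′), design note `STRATEGY-B-adapted-class-T3-alpha1-g5.md` §B.0–B.1): THE DISPLAYED
# DATA SCHEMA `DataSchemaT3AC F 𝔠 a₀ a₁` of the v3 socket `AlphaInputsT3AC.OfV3At` — what stays DISPLAYED once the composite minimisers are CONSTRUCTED as
# measurable argmin selections over the adapted class (`AlphaInputsT3ACv3AdaptedClass`) — lane `pub-balaban3d`, seat alpha-2 (g0)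

WHAT IS DISPLAYED (all `def … : Prop` ∕ `structure … : Prop` below are HYPOTHESIS SCHEMAS, OPEN, never asserted), per coupling `γ` and run `K`:
* §1 `AlphaV3AC.StepDataV3AC k` — the v3 step package `AlphaV3AC.StepAlphaV3AC k` MINUS its class-I row `hU` (measurability of `U_k(·, h)`, supplied by the
  construction): the 15 series-only rows, the 4 rows reading the AC objects, the (β) residual pair `fibre55Win`∕`fibre57Low`, the old-term rows `h44`∕`hfloor`,
  `Pint`'s regularity ((D1)–(D4) of the design note; `h44`∕`hfloor` are kept verbatim in this first cut — NODE O's split through `OldTermForm` is a later refinement);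
* §2 (N1) `WindowIneqT3` — the CONSTANTS side condition «(40)-window at the finest level ≤ (68)-regularity», necessary for `OfV3At` (alpha-1 certificate 19936 #57);
  (D6) `AdaptedClassNonemptyT3` — non-emptiness of the adapted classes at admissible non-trivial histories (kinematic; provable later by abelian witnesses);
  (D5) `TrivMinimiserRowsT3 … Ut` — [Balaban1985Variational] Thm 1 + Prop 7 (global reading) for a measurable trivial-history minimiser family `Ut` (`Ut 0 = id`),
  with the trivial-history instances of r2∕r3 at levels `k ≥ 1`; `AdaptedToT3 … Ut UkH` — the predicate «`U_k(·, h)` pinned to `Ut` at `triv`, measurable, and an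
  argmin of the Wilson action over `𝒞(k, h, W)` at non-trivial `h`»; (D1)–(D4), (D7) `DataRowsT3` — FOR EVERY adapted minimiser data there are expansion data `𝔖` and
  auxiliary data `𝔄` with the step data at every `k < K` and the terminal `Pint_K` rows; `DataSchemaT3AC` = (N1) ∧ (D6) ∧ ∃ `Ut`, (D5) ∧ data rows.
HONESTY LINE (design note §B.1, as in NODE O's `…ClassIDischarge` §6): the data rows are displayed FOR THE CONSTRUCTED minimisers (any adapted selection), whereas
print states them for its (42)-minimiser with the actual field history; at `h ≠ triv` the adapted-class argmin is a DIFFERENT variational problem — that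
identification is part of the displayed gap, not hidden.  (D5) is print's statement about ITS minimiser at the trivial history and is pinned, not discharged.
The assembly `AlphaInputsT3AC.ofV3At_of_dataSchemaT3 : DataSchemaT3AC F 𝔠 a₀ a₁ → OfV3At F 𝔠 a₀ a₁` is the sibling `AlphaInputsT3ACv3OfDataSchema`.
Count-neutral helper toward R3 2′ (`stub_laneRecordsV3`, items 19935∕19936); nothing of the cluster expansion is proved; nothing about d = 4, the continuum, or a mass gap.

References: T. Bałaban, Commun. Math. Phys. 102 (1985) 255–275 [Balaban1985UV3]; CMP 102 (1985) 277–309 [Balaban1985Variational].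
-/

set_option autoImplicit false

noncomputable section


namespace Summit.QuantumFields.YangMills.Theorems.AlphaV3AC

open MeasureTheory Metric
open scoped BigOperators Matrix.Norms.L2Operator
open Literature.MathematicalPhysics.QuantumFieldTheory.Balaban1983to89
open Literature.MathematicalPhysics.QuantumFieldTheory.Balaban1983to89.B10
open Literature.MathematicalPhysics.QuantumFieldTheory.Balaban1983to89.B10SectAGathering
open Literature.MathematicalPhysics.QuantumFieldTheory.Balaban1983to89.B10SectCExpansion (Bound44)
open Literature.MathematicalPhysics.QuantumFieldTheory.Balaban1983to89.B10Eq24Cumulant (chiMeasure)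
open Literature.MathematicalPhysics.QuantumFieldTheory.Balaban1983to89.TreeLengthTorus (tsys)
open Literature.MathematicalPhysics.QuantumFieldTheory.Balaban1985CMP102
open Literature.MathematicalPhysics.QuantumFieldTheory.Balaban1985CMP102.Setting
open Literature.MathematicalPhysics.QuantumFieldTheory.Balaban1985CMP102.Binders
  (ChartAnalyticityAsCited FarTermsDecayAsCited Norm35StepAsCited LogZTExtensiveAsCited GraphRep23AsCited)
open Summit.QuantumFields.Balaban3D.Carriers
open Summit.QuantumFields.Balaban3D.Proofs.Inputs
open Summit.QuantumFields.Balaban3D.Proofs.Primitives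
open Summit.QuantumFields.Balaban3D.Proofs.UVStability3DInputs (adjAct hdet_adjAct)
open Summit.QuantumFields.Balaban3D.Proofs.Representation33 (jet26)
open Summit.QuantumFields.Balaban3D.Proofs.LiftBridge (liftCfg)
open Summit.QuantumFields.Balaban3D.Proofs.Run3SmallFactors (codeZ)
open Summit.QuantumFields.Balaban3D.Proofs.GroupModelLieC (lieC)
open Summit.QuantumFields.Balaban3D.Proofs.TowerAC
open Summit.QuantumFields.Balaban3D.Proofs.SeriesAC
open Summit.QuantumFields.Balaban3D.Proofs.StandardAC
open Summit.QuantumFields.Balaban3D.Proofs.InputsAC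
open Summit.QuantumFields.Balaban3D.Proofs.Bound55AC
open Summit.QuantumFields.Balaban3D.Proofs.AlphaAC
open Summit.QuantumFields.Balaban3D.Proofs.AlphaAdaptersAC
open B7Prop1Explicit (hol plaqWord)
open B7Prop1Local (pdevOn loK plaqHiK)
open B7Prop2Explicit (avgIter)

variable {L : ℕ}

/-! ## §1 The DISPLAYED step data: `StepAlphaV3AC` minus the class-I row `hU` -/

section Data

variable {S : Scales L} {G : Type} [GaugeGroup G] [MeasurableSpace G] [HaarData G] (𝔊 : GroupModel G) (𝔠 : AlphaConsts L 𝔊.N)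
  (X : ExternalInputsAC S G) (𝔖 : ∀ k, StepSeries S G ↥(lieC 𝔊) (nblkOf S 𝔠.lane.carrier k) k) (𝔄 : AlphaDataAC 𝔊 𝔠 X 𝔖)
  (win : (k : ℕ) → Hist S.P (k + 1) → Set (GaugeField S.P (k + 1) G))

open Classical in
/-- **THE DISPLAYED (α) STEP DATA OF STEP `k → k+1`, VERSION 3** (design note §B.1 (D1)–(D4)): the rows of `AlphaV3AC.StepAlphaV3AC k` VERBATIM (same names,
texts, locators) EXCEPT the class-I row `hU` («`U_k(·, h)` is measurable»), which strategy B supplies BY CONSTRUCTION (measurable argmin selection).  What is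
left are the cluster-expansion DATA rows (series-only rows, the four rows reading the AC objects, the (β) residual pair `fibre55Win`∕`fibre57Low`, the old-term
rows `h44`∕`hfloor`, `Pint`'s regularity).  HYPOTHESES; nothing asserted. [cite: Balaban1985UV3, (23)–(33) pp.262–264 + (44) p.267 + (49)–(63) pp.268–272] -/
structure StepDataV3AC (k : ℕ) : Prop where
  /-- the Gaussian measure of (58) is a probability measure -/
  hμ : IsProbabilityMeasure (𝔖 k).μ
  /-- the small-field box is measurable -/
  hboxm : ∀ h, MeasurableSet ((𝔖 k).box h)
  /-- … of positive measure -/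
  hbox : ∀ h, (𝔖 k).μ ((𝔖 k).box h) ≠ 0
  /-- the effective potential is a.e.-measurable -/
  hVm : ∀ h U, AEMeasurable ((𝔖 k).𝒱 h U) (𝔖 k).μ
  /-- … and bounded on the box -/
  hVB : ∀ h U, ∀ ω ∈ (𝔖 k).box h, |(𝔖 k).𝒱 h U ω| ≤ 𝔄.Bv k
  /-- G3D-01 at the (25)-rate (R-ACT) -/
  chart : ∀ Y, ChartAnalyticityAsCited ((𝔖 k).Ψ Y) 𝔠.ρ
    (𝔠.C25 * S.gk k * Real.exp (-(𝔠.κ * (tsys 3 (nblkOf S 𝔠.lane.carrier k)).dj Y)))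
  /-- (28) p. 263 -/
  bound28 : ∀ Y h U, ‖(𝔖 k).Bcfg Y h U‖ ≤ 𝔠.cB * (rFun 𝔠.r₀ (S.gk k) * S.gk k * pFun 𝔠.b₀ 𝔠.p₀ (S.gk k))
  /-- (26) in the chart space, for the adjoint action -/
  inv26 : ∀ Y (U : G), ∀ b ∈ ball (0 : (𝔖 k).E) 𝔠.ρ, adjAct 𝔊 (P := S.P) k U b ∈ ball (0 : (𝔖 k).E) 𝔠.ρ →
    (𝔖 k).Ψ Y (adjAct 𝔊 (P := S.P) k U b) = (𝔖 k).Ψ Y b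
  /-- G3D-06 -/
  far_le : FarTermsDecayAsCited (𝔖 k).far
    (fun Y => 𝔠.C25 * S.gk k * Real.exp (-(𝔠.κ * (tsys 3 (nblkOf S 𝔠.lane.carrier k)).dj Y)))
    𝔠.Cfar (S.gk k ^ 7 * (rFun 𝔠.r₀ (S.gk k) * pFun 𝔠.b₀ 𝔠.p₀ (S.gk k)) ^ 7)
  /-- identification of `PY` with the retained jet (batch 11 (a)) -/
  hPY : ∀ h U, (𝔖 k).PY h U
    = ∑ Y ∈ (𝔖 k).loc (ΩblkOf 𝔠.lane.carrier.M₁ (rcolOf S 𝔠.lane.carrier) (nblkOf S 𝔠.lane.carrier k)) (rretOf S 𝔠.lane.carrier k) h,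
        ((jet26 ((𝔖 k).Ψ Y) ((𝔖 k).Bcfg Y h U)).re - (𝔖 k).far Y h U)
  /-- identification of `PYZ` with the retained jet of the G3D-07 pieces -/
  hPYZ : ∀ h U, (𝔖 k).PYZ h U
    = ∑ Y ∈ (𝔖 k).loc (ΩblkOf 𝔠.lane.carrier.M₁ (rcolOf S 𝔠.lane.carrier) (nblkOf S 𝔠.lane.carrier k)) (rretOf S 𝔠.lane.carrier k) h,
        ((jet26 ((𝔄.Λc k).Ψ Y) ((𝔖 k).Bcfg Y h U)).re - (𝔄.Λc k).far Y h U)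
  /-- G3D-04 -/
  norm35 : Norm35StepAsCited (piecesAC 𝔠.lane X 𝔖 k) 𝔠.c35 𝔠.a35 𝔠.cv 𝔠.cJ35
  /-- G3D-05 -/
  logZT : LogZTExtensiveAsCited (piecesAC 𝔠.lane X 𝔖 k) 𝔠.cT 𝔠.aT 𝔠.cn 𝔠.cJT
  /-- R-ACT: the graph carrier's activities are the chart activities -/
  hact : ∀ h Y U, ((𝔖 k).Gt h).activities.act Y U = (𝔖 k).act h Y U
  /-- G3D-02 -/
  hG : ∀ h, GraphRep23AsCited ((𝔖 k).Gt h) (fun U => ∑ n ∈ Finset.Icc 1 𝔠.nbar, (𝔖 k).cum h U n / (n.factorial : ℝ))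
    (𝔄.C₂₃ k) (𝔄.c₂₃ k) (𝔄.M₂₃ k) (𝔄.δ₀ k)
  /-- [B1] (3.24) input (a), in the unit `(L^kg₀²)^{3+κ₀}|T₁^{(k)}|` -/
  h324a : ∀ h (U : GaugeField S.P (k + 1) G), |Real.log ((𝔖 k).μ.real ((𝔖 k).box h))| ≤
    𝔠.Ca * ((L : ℝ) ^ k * S.g0sq) ^ (3 + 𝔠.κ₀) * S.sites k
  /-- [B1] (3.24) input (c) -/
  h324c : ∀ h U, ∀ t ∈ Set.Icc (0 : ℝ) 1, |iteratedDeriv (𝔠.nbar + 1) (ProbabilityTheory.cgf ((𝔖 k).𝒱 h U)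
    (chiMeasure (𝔖 k).μ (((𝔖 k).box h).indicator fun _ => (1 : ℝ)))) t| ≤
      𝔠.Cc * ((𝔠.nbar + 1).factorial : ℝ) * ((L : ℝ) ^ k * S.g0sq) ^ (3 + 𝔠.κ₀) * S.sites k
  /-- (44) p. 267 on the previous-scale terms of the data (ONE row: consumers B15 and C10) -/
  h44 : ∀ (h : Hist S.P (k + 1)) (U : GaugeField S.P (k + 1) G), ∀ j ∈ Finset.Icc 1 k,
    Bound44 (oldGeom S.P k j) (fun y n c => (𝔖 k).oldVal h U j y n c) 𝔠.κ₁ (𝔠.M₁ : ℝ) (ell S.P k j) (L : ℝ) 𝔠.B₃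
      (S.gk k) (pFun 𝔠.b₀ 𝔠.p₀ (S.gk k)) 𝔠.C44
  /-- the degree floor «n ≥ 2» of (43) for the previous-scale terms -/
  hfloor : ∀ (h : Hist S.P (k + 1)) (U : GaugeField S.P (k + 1) G), ∀ j ∈ Finset.Icc 1 k,
    ∀ (y : Site S.P j) (n : ℕ) (c : Fin n → PBond S.P j), (𝔖 k).oldVal h U j y n c ≠ 0 → 2 ≤ n
  /-- data regularity: the interaction sum `Pint k h` of (43) (DEFINED from the activities) is measurable in `U` … -/
  hPm : ∀ h : Hist S.P k, Measurable ((inputOfAC 𝔠.lane X 𝔖).Pint k h)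
  /-- … and bounded above -/
  hPb : ∀ (h : Hist S.P k) (U : GaugeField S.P k G), (inputOfAC 𝔠.lane X 𝔖).Pint k h U ≤ 𝔄.cP k
  /-- RESIDUAL R3D-01 (v3): (55) p.269 with (58) p.270 per new history, PINNED masses, print's `χ_{k+1}` window on the right (`PinnedStep.Fibre55WinAC`) -/
  fibre55Win : ∀ h' : Hist S.P (k + 1), PinnedStep.Fibre55WinAC 𝔠.lane X 𝔖 win k h'
  /-- RESIDUAL R3D-02 (p4): the lower step bound at the trivial history -/
  fibre57Low : Fibre57LowAC X 𝔠.lane.carrier 𝔖 (fun _ => True) k (piecesWAC 𝔠.lane X 𝔖 k)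

variable {𝔊 𝔠 X 𝔖 𝔄 win}

/-- **DATA + `hU` = THE v3 STEP PACKAGE**: the displayed data rows together with the measurability of `U_k(·, h)` give `StepAlphaV3AC k` (field by field).
[cite: Balaban1985UV3, (41) p.266 (bookkeeping)] -/
theorem StepDataV3AC.toStepAlpha {k : ℕ} (D : StepDataV3AC 𝔊 𝔠 X 𝔖 𝔄 win k) (hU : ∀ h : Hist S.P k, Measurable (X.UkH k h)) :
    StepAlphaV3AC 𝔊 𝔠 X 𝔖 𝔄 win k where
  hμ := D.hμ
  hboxm := D.hboxm
  hbox := D.hbox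
  hVm := D.hVm
  hVB := D.hVB
  chart := D.chart
  bound28 := D.bound28
  inv26 := D.inv26
  far_le := D.far_le
  hPY := D.hPY
  hPYZ := D.hPYZ
  norm35 := D.norm35
  logZT := D.logZT
  hact := D.hact
  hG := D.hG
  h324a := D.h324a
  h324c := D.h324c
  h44 := D.h44
  hfloor := D.hfloor
  hU := hU
  hPm := D.hPm
  hPb := D.hPb
  fibre55Win := D.fibre55Win
  fibre57Low := D.fibre57Low

end Data

end Summit.QuantumFields.YangMills.Theorems.AlphaV3AC

namespace Summit.QuantumFields.YangMills.Theorems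

open MeasureTheory Set
open scoped Matrix Matrix.Norms.L2Operator
open Literature.MathematicalPhysics.QuantumFieldTheory.Balaban1983to89
open Literature.MathematicalPhysics.QuantumFieldTheory.Balaban1983to89.B10 (pFun)
open Literature.MathematicalPhysics.QuantumFieldTheory.Balaban1983to89.T3ContinuumYM3Torus
open Literature.MathematicalPhysics.QuantumFieldTheory.Balaban1983to89.T3UnitLawDensityEML (ℰp)
open Literature.MathematicalPhysics.QuantumFieldTheory.Balaban1983to89.T3UnitScaleTilt (θBal)
open Literature.MathematicalPhysics.QuantumFieldTheory.Balaban1983to89.T3LevelShift (fieldShift)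
open Literature.MathematicalPhysics.QuantumFieldTheory.Balaban1983to89.T3PrintedRegularMinimiser (regFibrePr)
open Literature.MathematicalPhysics.QuantumFieldTheory.Balaban1983to89.B10Eq38TorusDomains (plaqsIn)
open Literature.MathematicalPhysics.QuantumFieldTheory.Balaban1983to89.B10Eq42TorusConstraint (bondsIn lam42 lam42_self)
open Literature.MathematicalPhysics.QuantumFieldTheory.Balaban1985CMP102
open Literature.MathematicalPhysics.QuantumFieldTheory.Balaban1985CMP102.Setting
open Summit.QuantumFields.Balaban3D.Carriers
open Summit.QuantumFields.Balaban3D.Proofs.Primitives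
open Summit.QuantumFields.Balaban3D.Proofs.GroupModelLieC (lieC)
open Summit.QuantumFields.Balaban3D.Proofs.LiftBridge (liftCfg)
open Summit.QuantumFields.Balaban3D.Proofs.TowerAC
open Summit.QuantumFields.Balaban3D.Proofs.StandardAC
open Summit.QuantumFields.Balaban3D.Proofs.InputsAC
open Summit.QuantumFields.Balaban3D.Proofs.AlphaAC (AlphaDataAC)
open Summit.QuantumFields.YangMills.Theorems.AlphaV3AC

/-! ## §2 The displayed schema `DataSchemaT3AC` -/

section Schema

variable (F : T3Family) (𝔠 : AlphaConsts F.L (suGroupModel 2).N) (γ : ℝ) (hγ : 0 < γ) (hγ1 : γ ≤ (min 𝔠.gamma0 1) ^ 2)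

/-- **(N1) THE WINDOW INEQUALITY OF RUN `K`** (a CONSTANTS side condition, no data; seat alpha-1's audit (N1) ∕ kernel certificate 19936 #57 «C68 window
necessary»): the datum's (40)-window at the finest level, `2L²·avgWindowFactor(L)·θBal(K+1)`, is within the (68)-regularity `C68·θBal(K)` — the `k = 0` instance of
row r3 at the trivial history, where `U_0(triv, ·) = id`; met by `C68 ≥ 302·L⁴·(1 + ½log L)^{p₀}` (design note §B.4). [cite: Balaban1985UV3, (40) p.266 + (68) p.273] -/
def AlphaInputsT3AC.WindowIneqT3 (K : ℕ) : Prop :=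
  2 * (F.L : ℝ) ^ 2 * avgWindowFactor F.L * θBal F.L γ 𝔠.b₀ 𝔠.p₀ (K + 1) ≤ 𝔠.C68 * θBal F.L γ 𝔠.b₀ 𝔠.p₀ K

/-- **(D6) NON-EMPTINESS OF THE ADAPTED CLASS** (hypothesis schema, never asserted; the (b11″)-type KINEMATIC row of the design note §B.1 (D6)): at every level
`k ≤ K`, every admissible NON-trivial history and every datum `W`, the adapted class `𝒞(k, h, W)` (`AlphaInputsT3AC.adaptedClassT3`) is non-empty — some
finest-lattice configuration in the two small-loop classes is (68)-regular on the `Ω_j(h)`, (67)-large at the recorded plaquettes of `h`, and, for charged `W`,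
has `k`-fold average `W` on `Ω_k(h)` with regular intermediate averages.  Expected provable by NODE O's abelian-witness technique (`…N08AlphaAbelianWindow/Cone`)
plus a smooth lift inside `Ω_k`; DISPLAYED here. [cite: Balaban1985UV3, (42) p.266 + (67)–(68) p.273; Balaban1985Variational, Thm 1 (8) p.279] -/
def AlphaInputsT3AC.AdaptedClassNonemptyT3 (K : ℕ) : Prop :=
  ∀ (k : ℕ), k ≤ K → ∀ (h : Hist (F.P K) k),
    Hist.Admissible 𝔠.lane.carrier.M₁ (rcolOf (T3Scales F γ hγ (hγ1.trans (sq_min_one_le _ 𝔠.gamma0_pos)) K) 𝔠.lane.carrier) k h →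
    h ≠ Hist.triv (F.P K) k → ∀ (W : GaugeField (F.P K) k (Matrix.specialUnitaryGroup (Fin 2) ℂ)),
      (AlphaInputsT3AC.adaptedClassT3 F 𝔠 γ hγ hγ1 K k h W).Nonempty

/-- **(D5) THE TRIVIAL-HISTORY MINIMISER ROWS** (hypothesis schema, never asserted): a family `Ut k : SU(2)^{bonds_k} → SU(2)^{bonds_0}` of MEASURABLE maps with
`Ut 0 = id` carrying (r1) [Balaban1985Variational] Thm 1 + Prop 7 in the GLOBAL reading — `MinimiserRowsT3`'s first conjunct with `U_{K−n}(triv, ·) := Ut (K−n)`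
(membership in the space (8) = `regFibrePr … (B₃ε₁) V` and minimality over (6) = `regFibrePr … ε₀ V`) — and, at the levels `1 ≤ k ≤ K` and for CHARGED data, the
trivial-history instances of r2 ((42)-top on all bonds: `Ω_k(triv) = T`) and r3 ((68) multi-level).  These are print's statements about ITS (42)-minimiser at the
trivial history, which no argmin over a `θ`-regular class can discharge (minimality over the larger space (6)); displayed, and PINNED into the construction.
[cite: Balaban1985Variational, Thm 1 (8) p.279 and Prop 7 p.299; Balaban1985UV3, (42) p.266 + (68) p.273] -/
def AlphaInputsT3AC.TrivMinimiserRowsT3 (a₀ a₁ : ℝ) (K : ℕ)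
    (Ut : (k : ℕ) → GaugeField (F.P K) k (Matrix.specialUnitaryGroup (Fin 2) ℂ) → GaugeField (F.P K) 0 (Matrix.specialUnitaryGroup (Fin 2) ℂ)) : Prop :=
  (∀ V, Ut 0 V = V) ∧ (∀ k, Measurable (Ut k)) ∧
  (∀ (n : ℕ) (hnK : n < K) (ε₁ ε₀ : ℝ), 0 < ε₁ → ε₁ ≤ a₁ → 𝔠.B₃ * ε₁ ≤ ε₀ → ε₀ ≤ a₀ →
    ∀ V : GaugeField (F.P n) 0 (Matrix.specialUnitaryGroup (Fin 2) ℂ), PlaqSmall ε₁ V →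
      Ut (K - n) (fieldShift (F.sitesPerDir_eq (m := F.m) (K := K) (j := K - n) (m' := F.m) (K' := n) (j' := 0) (by omega)) V) ∈
        regFibrePr F n K hnK.le (𝔠.B₃ * ε₁) V ∧
      IsMinOn (fun U : GaugeField (F.P K) 0 (Matrix.specialUnitaryGroup (Fin 2) ℂ) => wilsonAction4 U)
        (regFibrePr F n K hnK.le ε₀ V)
        (Ut (K - n) (fieldShift (F.sitesPerDir_eq (m := F.m) (K := K) (j := K - n) (m' := F.m) (K' := n) (j' := 0) (by omega)) V))) ∧
  (∀ (k : ℕ), 0 < k → k ≤ K → ∀ (W : GaugeField (F.P K) k (Matrix.specialUnitaryGroup (Fin 2) ℂ)),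
    ChargedT3 F γ 𝔠.b₀ 𝔠.p₀ (avgWindowFactor F.L) K 𝔠.lane.carrier.M₁
        (rcolOf (T3Scales F γ hγ (hγ1.trans (sq_min_one_le _ 𝔠.gamma0_pos)) K) 𝔠.lane.carrier) k (Hist.triv (F.P K) k) W →
      ∀ b : PBond (F.P K) k,
        b ∈ bondsIn k (Omega 𝔠.lane.carrier.M₁
          (rcolOf (T3Scales F γ hγ (hγ1.trans (sq_min_one_le _ 𝔠.gamma0_pos)) K) 𝔠.lane.carrier) k (Hist.triv (F.P K) k) k) →
        Averaging.iter (fun i => BlockAveraging.blockAvg (P := F.P K) (j := i) ℰp) k (Ut k W) b = W b) ∧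
  (∀ (k : ℕ), 0 < k → k ≤ K → ∀ (W : GaugeField (F.P K) k (Matrix.specialUnitaryGroup (Fin 2) ℂ)),
    ChargedT3 F γ 𝔠.b₀ 𝔠.p₀ (avgWindowFactor F.L) K 𝔠.lane.carrier.M₁
        (rcolOf (T3Scales F γ hγ (hγ1.trans (sq_min_one_le _ 𝔠.gamma0_pos)) K) 𝔠.lane.carrier) k (Hist.triv (F.P K) k) W →
      ∀ i, i ≤ k → ∀ s, s ≤ i → ∀ q : Plaq (F.P K) s,
        q ∈ plaqsIn s (lam42 (Omega 𝔠.lane.carrier.M₁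
          (rcolOf (T3Scales F γ hγ (hγ1.trans (sq_min_one_le _ 𝔠.gamma0_pos)) K) 𝔠.lane.carrier) k (Hist.triv (F.P K) k)) k i) →
        GaugeGroup.dist1 (GaugeField.plaqHol
            (Averaging.iter (fun l => BlockAveraging.blockAvg (P := F.P K) (j := l) ℰp) s (Ut k W)) q) ≤
          𝔠.C68 * θBal F.L γ 𝔠.b₀ 𝔠.p₀ (K - i) * (((F.L : ℝ) ^ (i - s))⁻¹) ^ 2)

/-- **ADAPTED MINIMISER DATA** (the predicate the displayed data rows quantify over; design note §B.2): composite-minimiser maps `U_k(·, h)` that are PINNED to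
the trivial-history family `Ut` at `h = triv`, MEASURABLE for every `(k, h)`, and, at every non-trivial history of the run's levels `k ≤ K`, select a MINIMISER
of the Wilson action over the adapted class `𝒞(k, h, W)` whenever that class is non-empty.  Satisfied by the construction of `ofV3At_of_dataSchemaT3`.
[cite: Balaban1985UV3, (42) p.266; Balaban1985Variational, Thm 1 (8) p.279 (measurable-selection reading)] -/
def AlphaInputsT3AC.AdaptedToT3 (K : ℕ)
    (Ut : (k : ℕ) → GaugeField (F.P K) k (Matrix.specialUnitaryGroup (Fin 2) ℂ) → GaugeField (F.P K) 0 (Matrix.specialUnitaryGroup (Fin 2) ℂ))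
    (UkH : (k : ℕ) → Hist (F.P K) k → GaugeField (F.P K) k (Matrix.specialUnitaryGroup (Fin 2) ℂ) →
      GaugeField (F.P K) 0 (Matrix.specialUnitaryGroup (Fin 2) ℂ)) : Prop :=
  (∀ k, UkH k (Hist.triv (F.P K) k) = Ut k) ∧
  (∀ (k : ℕ) (h : Hist (F.P K) k), Measurable (UkH k h)) ∧
  (∀ (k : ℕ), k ≤ K → ∀ (h : Hist (F.P K) k), h ≠ Hist.triv (F.P K) k →
    ∀ (W : GaugeField (F.P K) k (Matrix.specialUnitaryGroup (Fin 2) ℂ)), (AlphaInputsT3AC.adaptedClassT3 F 𝔠 γ hγ hγ1 K k h W).Nonempty →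
      UkH k h W ∈ AlphaInputsT3AC.adaptedClassT3 F 𝔠 γ hγ hγ1 K k h W ∧
        IsMinOn (fun U : GaugeField (F.P K) 0 (Matrix.specialUnitaryGroup (Fin 2) ℂ) => wilsonAction4 U)
          (AlphaInputsT3AC.adaptedClassT3 F 𝔠 γ hγ hγ1 K k h W) (UkH k h W))

/-- **(D1)–(D4), (D7) THE DISPLAYED CLUSTER-EXPANSION DATA ROWS** (hypothesis schema, never asserted; design note §B.1): for EVERY adapted minimiser data `U_k(·, h)`
(`AdaptedToT3 … Ut UkH`, with `U_k := U_{k+1}(·, triv)`, regular classes `univ`, `U_0(·, triv) = id`), there are expansion data `𝔖` and auxiliary data `𝔄` for the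
pinned AC inputs `XT3` such that the displayed step data `AlphaV3AC.StepDataV3AC` hold at every step `k < K` for the (40) windows `admWindowT3`, and the terminal
`Pint_K` rows hold — print's (α) data «for the minimisers at hand», as in [Balaban1985UV3] Sect. B–C (the data may depend on the minimisers).
[cite: Balaban1985UV3, Thm 2 p.272 + (41) p.266 + (55) p.269] -/
def AlphaInputsT3AC.DataRowsT3 (K : ℕ)
    (Ut : (k : ℕ) → GaugeField (F.P K) k (Matrix.specialUnitaryGroup (Fin 2) ℂ) → GaugeField (F.P K) 0 (Matrix.specialUnitaryGroup (Fin 2) ℂ)) : Prop :=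
  ∀ (UkH : (k : ℕ) → Hist (F.P K) k → GaugeField (F.P K) k (Matrix.specialUnitaryGroup (Fin 2) ℂ) →
      GaugeField (F.P K) 0 (Matrix.specialUnitaryGroup (Fin 2) ℂ))
    (hU0 : ∀ V : GaugeField (F.P K) 0 (Matrix.specialUnitaryGroup (Fin 2) ℂ), UkH 0 (Hist.triv (F.P K) 0) V = V),
    AlphaInputsT3AC.AdaptedToT3 F 𝔠 γ hγ hγ1 K Ut UkH →
    ∃ (𝔖 : ∀ k, StepSeries (T3Scales F γ hγ (hγ1.trans (sq_min_one_le _ 𝔠.gamma0_pos)) K)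
        (Matrix.specialUnitaryGroup (Fin 2) ℂ) ↥(lieC (suGroupModel 2))
        (nblkOf (T3Scales F γ hγ (hγ1.trans (sq_min_one_le _ 𝔠.gamma0_pos)) K) 𝔠.lane.carrier k) k)
      (𝔄 : AlphaDataAC (suGroupModel 2) 𝔠
        (XT3 F γ hγ (hγ1.trans (sq_min_one_le _ 𝔠.gamma0_pos)) K (fun _ => Set.univ)
          (fun k => UkH (k + 1) (Hist.triv (F.P K) (k + 1))) UkH hU0 (fun _ _ => rfl)) 𝔖),
      (∀ k, k + 1 ≤ K → StepDataV3AC (suGroupModel 2) 𝔠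
        (XT3 F γ hγ (hγ1.trans (sq_min_one_le _ 𝔠.gamma0_pos)) K (fun _ => Set.univ)
          (fun k => UkH (k + 1) (Hist.triv (F.P K) (k + 1))) UkH hU0 (fun _ _ => rfl)) 𝔖 𝔄
        (AlphaInputsT3AC.admWindowT3 F 𝔠 γ hγ hγ1 K) k) ∧
      (∀ h : Hist (F.P K) K, Measurable ((inputOfAC 𝔠.lane
        (XT3 F γ hγ (hγ1.trans (sq_min_one_le _ 𝔠.gamma0_pos)) K (fun _ => Set.univ)
          (fun k => UkH (k + 1) (Hist.triv (F.P K) (k + 1))) UkH hU0 (fun _ _ => rfl)) 𝔖).Pint K h)) ∧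
      (∀ (h : Hist (F.P K) K) (U : GaugeField (F.P K) K (Matrix.specialUnitaryGroup (Fin 2) ℂ)), (inputOfAC 𝔠.lane
        (XT3 F γ hγ (hγ1.trans (sq_min_one_le _ 𝔠.gamma0_pos)) K (fun _ => Set.univ)
          (fun k => UkH (k + 1) (Hist.triv (F.P K) (k + 1))) UkH hU0 (fun _ _ => rfl)) 𝔖).Pint K h U ≤ 𝔄.cP K)

end Schema

/-- **`DataSchemaT3AC F 𝔠 a₀ a₁` — THE DISPLAYED DATA SCHEMA OF STRATEGY B** (hypothesis schema, OPEN, never asserted; design note §B.0–B.1): for every coupling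
`γ ∈ (0, (min γ₀ 1)²]` and run `K`: (N1) the window inequality of the constants; (D6) non-emptiness of the adapted classes; and a trivial-history minimiser
family `Ut` with (D5) [7] Thm 1's rows, for which (D1)–(D4), (D7) the cluster-expansion data rows hold for every adapted minimiser data.  With it
`ofV3At_of_dataSchemaT3` CONSTRUCTS the v3 package `OfV3At F 𝔠 a₀ a₁`: 2′ re-cut to «displayed DATA + [7] Thm 1 + non-emptiness», NODE O's floor in the T³∕AC letters.
[cite: Balaban1985UV3, Thm 2 p.272 + (40)–(42) p.266 + (55) p.269 + (67)–(68) p.273; Balaban1985Variational, Thm 1 (8) p.279] -/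
def DataSchemaT3AC (F : T3Family) (𝔠 : AlphaConsts F.L (suGroupModel 2).N) (a₀ a₁ : ℝ) : Prop :=
  ∀ (γ : ℝ) (hγ : 0 < γ) (hγ1 : γ ≤ (min 𝔠.gamma0 1) ^ 2) (K : ℕ),
    AlphaInputsT3AC.WindowIneqT3 F 𝔠 γ K ∧
    AlphaInputsT3AC.AdaptedClassNonemptyT3 F 𝔠 γ hγ hγ1 K ∧
    ∃ Ut : (k : ℕ) → GaugeField (F.P K) k (Matrix.specialUnitaryGroup (Fin 2) ℂ) → GaugeField (F.P K) 0 (Matrix.specialUnitaryGroup (Fin 2) ℂ),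
      AlphaInputsT3AC.TrivMinimiserRowsT3 F 𝔠 γ hγ hγ1 a₀ a₁ K Ut ∧ AlphaInputsT3AC.DataRowsT3 F 𝔠 γ hγ hγ1 K Ut

end Summit.QuantumFields.YangMills.Theorems

end
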